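/-
Copyright (c) 2026 the pub-hodgecm-mathlib formalisation cell (harness21).  Prover seat hodgecm-mathlib-LH4-p10 (g3): dealer LH4-plan (g12) WORD #4 (3) ∕ WORD #6 (3) — the OF-RECORD
INSTANTIATION of DEFS LEAF №1-R2 (★ p856987) at LH4-p04 (g2)'s glue-sign token (★ p856975), under the (R-22) «κS-RECUT» ORDER OF SHAPE (heir LEAD F0P3a-plan (g19) T18-53 Q1 option A).  2026-09-04.
-/
import Summits.HodgeConjecture.HodgeConjecture.Theorems.F0P3cDyRamFourFrameLawDefsR2      -- ★ DEFS LEAF №1-R2 (this seat, p856987): `OmegaSchedule`, `KappaSignLawAtR2 Ω`, `FourFrameLawsWildOfRecordR2 Ω`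
import Summits.HodgeConjecture.HodgeConjecture.Theorems.F0P3cDyRamDiagonalGlueSignDefs    -- ★ Ω DEFS LEAF (LH4-p04 (g2), p856975): `glueSign`, `glueSignR σ ϖ d a b i = glueSign σ ϖ d (![b, a, b ∕ a] i)`
import HarnessLib

/-!
# F0 · P3c · line LH4 «(D-RAM) FOUR-FRAME» — DEFS LEAF «ΩR» (`omegaR`): THE SIGN-TOKEN SCHEDULE OF RECORD of the Ω-aware κ-sign law (R-22 «κS-RECUT», T18-53)

Cell `pub/hodgecm-mathlib`, crux H413 = `stmt-HodgeConjecture-24833` (helper lane `--supports stmt-HodgeConjecture-24833 --as helper`), route HCCMUnconditional.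
DEF LANE: one `def` + `rfl` ties; no instance, no notation, no sorry, nothing asserted.

WHAT.  ★ №1-R2 (`F0P3cDyRamFourFrameLawDefsR2`) types the κ-sign law with an ABSTRACT sign-token schedule `Ω : OmegaSchedule` (`Ω K σ ϖ d a b i : ℤ`); ★ p856975
(`F0P3cDyRamDiagonalGlueSignDefs`) types the CONCRETE token `glueSignR σ ϖ d a b i = glueSign σ ϖ d (![b, a, b ∕ a] i)` — the norm class `ω` of a `σ`-fixed unit representative
of the symmetric unit `c_i ∈ {b, a, b∕a}` of slot `i` modulo `U_E^{(2d−1)}`, junk `1` (REF5 (g22) R5-115 (2); LEAD T18-53 Q1 option A, Q5 both vertex types).  This leaf is the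
5-line glue the ORDER OF SHAPE asked for (pen WORD #4 (g12) (3): «take the `ΩR` ∕ `shiftR` names from LH4-p10 (g3)'s leaf»):
* `omegaR : OmegaSchedule := fun K _ _ σ ϖ d a b i => glueSignR σ ϖ d a b i` — THE SCHEDULE OF RECORD (the ORDER's `ΩR`; ASCII identifier `omegaR` so that every ledger ∕ audit
  regex reads the name; the token prints `omegaR K σ ϖ d a b i`);
* `omegaR_apply` (`rfl`): `omegaR K σ ϖ d a b i = glueSignR σ ϖ d a b i`; `omegaR_apply_eq_glueSign` (`rfl`): `= glueSign σ ϖ d (![b, a, b ∕ a] i)`; the slot table `omegaR_slot_zero ∕ _one ∕ _two`, `omegaR_eq_one_or`.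
The U3 «κS-RECUT» edition (ED. 11b) prints `DyadicFence (KappaSignLawAtR2 omegaR depthOfRecord tauOfRecord σ ϖ d t)` for `stub_U3_kappaSignLawR2`, the RHS sign
`omegaR K σ ϖ d a b i * (![normSign σ (-1), normSign σ (-1), 1] i * (baseSign σ i * normSign σ (fPartProd δ ![a, b, 1] i)))` in (κS-B₀²) ∕ (κS-B₂²) ∕ KSS², and the closed Prop
`FourFrameLawsWildOfRecordR2 omegaR`; the transport is ★ p856997 `dyadicFence_kappaSignLawAtR2_of_kappaSignModelSum2_8 omegaR`, the covered-set bridge of record is the sequel theorems file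
`F0P3cDyRamKappaSignLawR2OfRecord` (★ p857007's ∨-bridge fed with the discharge «`omegaR = 1` or axis not read» under `d % 2 = 1 ∨ 2 * d ≤ t + 2`).
EVERY LAW PROP INSTANTIATED HERE IS A CENSUS LAW — a PROVER TARGET, never a literature fact; this file asserts nothing.
HONEST LABEL: HC_CM is proved only modulo the 7 printed citations (2 remaining: hLiu418 = stmt-HodgeConjecture-24832, h413 = stmt-HodgeConjecture-24833) until rung 0 closes;
count-neutral vehicle.

## References
* [LanglandsShelstad1987] R. P. Langlands, D. Shelstad, *On the definition of transfer factors*, Math. Ann. 278 (1987), §1.3, §3 (the κ-signs of the classes in a stable class).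
* [Rogawski1990] J. D. Rogawski, *Automorphic Representations of Unitary Groups in Three Variables*, Ann. of Math. Stud. 123 (1990): §4.9 Prop. 4.9.1 (a) p. 55, §4.10 p. 58.
* [Serre1979] J.-P. Serre, *Local Fields*, GTM 67 (1979): Ch. V §3 Prop. 5, Cor. 3.
-/

set_option autoImplicit false

noncomputable section

namespace Summit.HodgeConjecture.HodgeConjecture.Cruxes.H413.F0P3cDyRamOmegaRDefs

open scoped Valued WithZero
open Summit.HodgeConjecture.HodgeConjecture.Cruxes.H413.F0P3cDyRamFourFrameLawDefsR2
open Summit.HodgeConjecture.HodgeConjecture.Cruxes.H413.F0P3cDyRamDiagonalGlueSignDefs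

/-- **ΩR = `omegaR` · THE SIGN-TOKEN SCHEDULE OF RECORD** (R-22, T18-53 Q1 option A): slot `i` of the square datum `(a, b)` ↦ `glueSignR σ ϖ d a b i = Ω(![b, a, b ∕ a] i)` — the norm class of a
`σ`-fixed unit representative of the symmetric unit of the slot modulo `U_E^{(2d−1)}`, junk `1` (REF5 R5-115 (2)).  An `OmegaSchedule` (`K` explicit, no `t`).
[cite: LanglandsShelstad1987, §3] [cite: Rogawski1990, §4.10 p. 58] -/
def omegaR : OmegaSchedule := fun _ _ _ σ ϖ d a b i => glueSignR σ ϖ d a b i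

/-- `omegaR K σ ϖ d a b i = glueSignR σ ϖ d a b i` — `rfl` (the token the U3 ED. 11b children, KSS² and K-SGN-R2 print). [cite: Rogawski1990, §4.10 p. 58] -/
theorem omegaR_apply {K : Type} [Field K] [Valued K ℤᵐ⁰] (σ : K →+* K) (ϖ : K) (d : ℕ) (a b : K) (i : Fin 3) :
    omegaR K σ ϖ d a b i = glueSignR σ ϖ d a b i := rfl

/-- `omegaR K σ ϖ d a b i = glueSign σ ϖ d (![b, a, b ∕ a] i)` — `rfl` through ★ `glueSignR_eq`. [cite: Rogawski1990, §4.10 p. 58] -/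
theorem omegaR_apply_eq_glueSign {K : Type} [Field K] [Valued K ℤᵐ⁰] (σ : K →+* K) (ϖ : K) (d : ℕ) (a b : K) (i : Fin 3) :
    omegaR K σ ϖ d a b i = glueSign σ ϖ d ((![b, a, b / a] : Fin 3 → K) i) := rfl

/-- Slot `0` of the schedule of record: `Ω(b)`. [cite: Rogawski1990, §4.10 p. 58] -/
theorem omegaR_slot_zero {K : Type} [Field K] [Valued K ℤᵐ⁰] (σ : K →+* K) (ϖ : K) (d : ℕ) (a b : K) : omegaR K σ ϖ d a b 0 = glueSign σ ϖ d b := rfl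

/-- Slot `1` of the schedule of record: `Ω(a)`. [cite: Rogawski1990, §4.10 p. 58] -/
theorem omegaR_slot_one {K : Type} [Field K] [Valued K ℤᵐ⁰] (σ : K →+* K) (ϖ : K) (d : ℕ) (a b : K) : omegaR K σ ϖ d a b 1 = glueSign σ ϖ d a := rfl

/-- Slot `2` of the schedule of record: `Ω(b ∕ a)`. [cite: Rogawski1990, §4.10 p. 58] -/
theorem omegaR_slot_two {K : Type} [Field K] [Valued K ℤᵐ⁰] (σ : K →+* K) (ϖ : K) (d : ℕ) (a b : K) : omegaR K σ ϖ d a b 2 = glueSign σ ϖ d (b / a) := rfl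

/-- `omegaR` takes values in `{−1, 1}` (★ `glueSign_eq_one_or`). [cite: Serre1979, Ch. V §3 Prop. 5, Cor. 3] -/
theorem omegaR_eq_one_or {K : Type} [Field K] [Valued K ℤᵐ⁰] (σ : K →+* K) (ϖ : K) (d : ℕ) (a b : K) (i : Fin 3) :
    omegaR K σ ϖ d a b i = 1 ∨ omegaR K σ ϖ d a b i = -1 :=
  glueSign_eq_one_or σ ϖ d _

end Summit.HodgeConjecture.HodgeConjecture.Cruxes.H413.F0P3cDyRamOmegaRDefs

end
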